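import Summits.QuantumFields.YangMills.Theorems.ColdStartUniversalityLatticeLangevinRidgeMoments
import Mathlib.MeasureTheory.Measure.CharacteristicFunction.Basic
import HarnessLib

/-!
# Route `ColdStartUniversality`, crux K_A1 `UniformColdStartMixing` (stmt-QuantumFields-24809), rung `stub_fixedCutoffMixing`:
# ridge-moment determinacy on `SU(2)^E` (Cramér–Wold)

Helper file (seat `ym-line-csu-p1`, g7).  **Two finite measures on `SU(2)^E` which integrate every latitude eigenfunction
`y ↦ ∏_e U_{m_e}(⟨ρ g_e, ρ y_e⟩)` identically are equal** (`measure_eq_of_forall_integral_prod_gegenbauer_eq`).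
Proof: embed `SU(2)^E ⊆ (ℝ⁴)^E` by the quaternion coordinates `(Re a, Im a, Re b, Im b)` of `[[a, b], [-b̄, ā]]`
(a continuous injection of a compact space, hence a measurable embedding); the Euclidean pairing with a covector `ξ` is a
ridge sum `Σ_e r_e ⟨ρ g_e, ρ y_e⟩` (every vector of `ℝ⁴` is a multiple of a unit quaternion = an `SU(2)` matrix), so by
`integral_cexp_ridge_eq` the characteristic functions of the two image measures coincide, and Mathlib's
`Measure.ext_of_charFun` identifies them.  No definition, no sorry.  RECORD-rung R3 plumbing; nothing here bears on the
mass gap.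
-/

set_option autoImplicit false

noncomputable section

namespace Summit.QuantumFields.YangMills.Theorems.ColdStartUniversality

open MeasureTheory Finset
open scoped BigOperators
open Literature.MathematicalPhysics.QuantumFieldTheory
open Literature.MathematicalPhysics.QuantumLattice (fundamentalRep)
open Literature.Analysis.SpecialFunctions (gegenbauerSum)

variable {L : ℕ} [NeZero L]

/-- **`⟨q(g), q(y)⟩_{ℝ⁴} = ½ hsForm 2 g y`** for the quaternion coordinates `q = (Re a, Im a, Re b, Im b)` of `SU(2)`
matrices `[[a, b], [-b̄, ā]]`. [folklore] -/
theorem quatCoord_pairing_eq_hsForm (g y : Matrix.specialUnitaryGroup (Fin 2) ℂ) :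
    ((g : Matrix (Fin 2) (Fin 2) ℂ) 0 0).re * ((y : Matrix (Fin 2) (Fin 2) ℂ) 0 0).re +
      ((g : Matrix (Fin 2) (Fin 2) ℂ) 0 0).im * ((y : Matrix (Fin 2) (Fin 2) ℂ) 0 0).im +
      ((g : Matrix (Fin 2) (Fin 2) ℂ) 0 1).re * ((y : Matrix (Fin 2) (Fin 2) ℂ) 0 1).re +
      ((g : Matrix (Fin 2) (Fin 2) ℂ) 0 1).im * ((y : Matrix (Fin 2) (Fin 2) ℂ) 0 1).im =
      hsForm 2 (fundamentalRep (Fin 2) g) (fundamentalRep (Fin 2) y) / 2 := by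
  have hg11 : (g : Matrix (Fin 2) (Fin 2) ℂ) 1 1 = starRingEnd ℂ ((g : Matrix (Fin 2) (Fin 2) ℂ) 0 0) := apply_one_one_eq g.2
  have hg10 : (g : Matrix (Fin 2) (Fin 2) ℂ) 1 0 = -starRingEnd ℂ ((g : Matrix (Fin 2) (Fin 2) ℂ) 0 1) := apply_one_zero_eq g.2
  have hy11 : (y : Matrix (Fin 2) (Fin 2) ℂ) 1 1 = starRingEnd ℂ ((y : Matrix (Fin 2) (Fin 2) ℂ) 0 0) := apply_one_one_eq y.2
  have hy10 : (y : Matrix (Fin 2) (Fin 2) ℂ) 1 0 = -starRingEnd ℂ ((y : Matrix (Fin 2) (Fin 2) ℂ) 0 1) := apply_one_zero_eq y.2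
  rw [hsForm_eq_sum_entries]
  simp only [Fin.sum_univ_two]
  rw [show (fundamentalRep (Fin 2) g : Matrix (Fin 2) (Fin 2) ℂ) = (g : Matrix (Fin 2) (Fin 2) ℂ) from rfl,
    show (fundamentalRep (Fin 2) y : Matrix (Fin 2) (Fin 2) ℂ) = (y : Matrix (Fin 2) (Fin 2) ℂ) from rfl,
    hg11, hg10, hy11, hy10]
  simp only [Complex.mul_re, Complex.conj_re, Complex.conj_im, Complex.neg_re, Complex.neg_im, map_neg]
  ring

/-- **Every vector of `ℝ⁴` is a multiple of the coordinate vector of an `SU(2)` matrix**: for `v : Fin 4 → ℝ` there are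
`r : ℝ` and `g ∈ SU(2)` with `Σ_k v_k q_k(y) = r · ½ hsForm 2 g y` for all `y ∈ SU(2)`. [folklore] -/
theorem exists_smul_hsForm_eq_pairing (v : Fin 4 → ℝ) :
    ∃ (r : ℝ) (g : Matrix.specialUnitaryGroup (Fin 2) ℂ), ∀ y : Matrix.specialUnitaryGroup (Fin 2) ℂ,
      v 0 * ((y : Matrix (Fin 2) (Fin 2) ℂ) 0 0).re + v 1 * ((y : Matrix (Fin 2) (Fin 2) ℂ) 0 0).im +
        v 2 * ((y : Matrix (Fin 2) (Fin 2) ℂ) 0 1).re + v 3 * ((y : Matrix (Fin 2) (Fin 2) ℂ) 0 1).im =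
      r * (hsForm 2 (fundamentalRep (Fin 2) g) (fundamentalRep (Fin 2) y) / 2) := by
  set S : ℝ := v 0 * v 0 + v 1 * v 1 + v 2 * v 2 + v 3 * v 3 with hS
  by_cases hv : S = 0
  · -- `v = 0`
    have h0 : v 0 = 0 := by nlinarith [mul_self_nonneg (v 0), mul_self_nonneg (v 1), mul_self_nonneg (v 2), mul_self_nonneg (v 3)]
    have h1 : v 1 = 0 := by nlinarith [mul_self_nonneg (v 0), mul_self_nonneg (v 1), mul_self_nonneg (v 2), mul_self_nonneg (v 3)]
    have h2 : v 2 = 0 := by nlinarith [mul_self_nonneg (v 0), mul_self_nonneg (v 1), mul_self_nonneg (v 2), mul_self_nonneg (v 3)]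
    have h3 : v 3 = 0 := by nlinarith [mul_self_nonneg (v 0), mul_self_nonneg (v 1), mul_self_nonneg (v 2), mul_self_nonneg (v 3)]
    refine ⟨0, 1, fun y => ?_⟩
    rw [h0, h1, h2, h3]; ring
  · have hS0 : 0 ≤ S := by
      rw [hS]; nlinarith [mul_self_nonneg (v 0), mul_self_nonneg (v 1), mul_self_nonneg (v 2), mul_self_nonneg (v 3)]
    have hSpos : 0 < S := lt_of_le_of_ne hS0 (Ne.symm hv)
    set n : ℝ := Real.sqrt S with hn
    have hnpos : 0 < n := Real.sqrt_pos.2 hSpos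
    have hnsq : n * n = S := Real.mul_self_sqrt hSpos.le
    set a : ℝ := v 0 / n with ha
    set b : ℝ := v 1 / n with hb
    set c : ℝ := v 2 / n with hc
    set d : ℝ := v 3 / n with hd
    set M : Matrix (Fin 2) (Fin 2) ℂ := !![(a : ℂ) + (b : ℂ) * Complex.I, (c : ℂ) + (d : ℂ) * Complex.I;
      -(c : ℂ) + (d : ℂ) * Complex.I, (a : ℂ) - (b : ℂ) * Complex.I] with hM
    have hsum : a ^ 2 + b ^ 2 + c ^ 2 + d ^ 2 = 1 := by
      rw [ha, hb, hc, hd, div_pow, div_pow, div_pow, div_pow, ← add_div, ← add_div, ← add_div,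
        div_eq_one_iff_eq (pow_ne_zero 2 hnpos.ne')]
      nlinarith [hnsq]
    obtain ⟨h00re, h00im, h01re, h01im, -, -, -, -⟩ := quat_entries a b c d
    have hM11 : M 1 1 = starRingEnd ℂ (M 0 0) := by
      apply Complex.ext <;> simp [hM]
    have hM10 : M 1 0 = -starRingEnd ℂ (M 0 1) := by
      apply Complex.ext <;> simp [hM]
    have hMhs : hsForm 2 M M = 2 := by rw [hM, hsForm_quat, hsum]; norm_num
    have hMmem : M ∈ Matrix.specialUnitaryGroup (Fin 2) ℂ := mem_specialUnitaryGroup_of_quaternion hM11 hM10 hMhs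
    refine ⟨n, ⟨M, hMmem⟩, fun y => ?_⟩
    have hq := quatCoord_pairing_eq_hsForm ⟨M, hMmem⟩ y
    rw [← hq]
    change _ = n * ((M 0 0).re * _ + (M 0 0).im * _ + (M 0 1).re * _ + (M 0 1).im * _)
    rw [hM, h00re, h00im, h01re, h01im, ha, hb, hc, hd]
    field_simp

/-- **Ridge-moment determinacy (Cramér–Wold on `SU(2)^E`).** Two finite measures on the configuration space
`SU(2)^E` that integrate all latitude eigenfunctions `∏_e U_{m_e}(⟨ρ g_e, ρ y_e⟩)` identically are equal. [folklore] -/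
theorem measure_eq_of_forall_integral_prod_gegenbauer_eq
    {μ ν : Measure (GaugeConfig 3 L (Matrix.specialUnitaryGroup (Fin 2) ℂ))} [IsFiniteMeasure μ] [IsFiniteMeasure ν]
    (h : ∀ (g : Edge 3 L → Matrix.specialUnitaryGroup (Fin 2) ℂ) (m : Edge 3 L → ℕ),
      ∫ y, ∏ e, gegenbauerSum 1 (m e) (hsForm 2 (fundamentalRep (Fin 2) (g e)) (fundamentalRep (Fin 2) (y e)) / 2) ∂μ =
      ∫ y, ∏ e, gegenbauerSum 1 (m e) (hsForm 2 (fundamentalRep (Fin 2) (g e)) (fundamentalRep (Fin 2) (y e)) / 2) ∂ν) :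
    μ = ν := by
  classical
  haveI := secondCountableTopology_su2
  haveI := borelSpace_config L
  -- the embedding into `(ℝ⁴)^E`
  set ι : GaugeConfig 3 L (Matrix.specialUnitaryGroup (Fin 2) ℂ) → EuclideanSpace ℝ (Edge 3 L × Fin 4) := fun y =>
    WithLp.toLp 2 fun p : Edge 3 L × Fin 4 =>
      (![((y p.1 : Matrix (Fin 2) (Fin 2) ℂ) 0 0).re, ((y p.1 : Matrix (Fin 2) (Fin 2) ℂ) 0 0).im,
        ((y p.1 : Matrix (Fin 2) (Fin 2) ℂ) 0 1).re, ((y p.1 : Matrix (Fin 2) (Fin 2) ℂ) 0 1).im] : Fin 4 → ℝ) p.2 with hι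
  have hcoord : ∀ e : Edge 3 L, Continuous fun y : GaugeConfig 3 L (Matrix.specialUnitaryGroup (Fin 2) ℂ) =>
      (![((y e : Matrix (Fin 2) (Fin 2) ℂ) 0 0).re, ((y e : Matrix (Fin 2) (Fin 2) ℂ) 0 0).im,
        ((y e : Matrix (Fin 2) (Fin 2) ℂ) 0 1).re, ((y e : Matrix (Fin 2) (Fin 2) ℂ) 0 1).im] : Fin 4 → ℝ) := by
    intro e
    have hc : Continuous fun y : GaugeConfig 3 L (Matrix.specialUnitaryGroup (Fin 2) ℂ) => (y e : Matrix (Fin 2) (Fin 2) ℂ) :=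
      continuous_subtype_val.comp (continuous_apply e)
    refine continuous_pi fun k => ?_
    fin_cases k
    · simp only [Fin.zero_eta, Fin.isValue, Matrix.cons_val_zero]
      exact Complex.continuous_re.comp (hc.matrix_elem 0 0)
    · simp only [Fin.mk_one, Fin.isValue, Matrix.cons_val_one]
      exact Complex.continuous_im.comp (hc.matrix_elem 0 0)
    · simp only [Fin.reduceFinMk, Fin.isValue, Matrix.cons_val]
      exact Complex.continuous_re.comp (hc.matrix_elem 0 1)
    · simp only [Fin.reduceFinMk, Fin.isValue, Matrix.cons_val]
      exact Complex.continuous_im.comp (hc.matrix_elem 0 1)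
  have hιc : Continuous ι := by
    refine (PiLp.continuous_toLp 2 _).comp (continuous_pi fun p => ?_)
    exact (continuous_apply p.2).comp (hcoord p.1)
  have hιinj : Function.Injective ι := by
    intro y y' hyy'
    funext e
    have hq : ∀ k : Fin 4, (ι y) (e, k) = (ι y') (e, k) := fun k => by rw [hyy']
    have h0 : ((y e : Matrix (Fin 2) (Fin 2) ℂ) 0 0).re = ((y' e : Matrix (Fin 2) (Fin 2) ℂ) 0 0).re := by
      simpa [hι] using hq 0
    have h1 : ((y e : Matrix (Fin 2) (Fin 2) ℂ) 0 0).im = ((y' e : Matrix (Fin 2) (Fin 2) ℂ) 0 0).im := by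
      simpa [hι] using hq 1
    have h2 : ((y e : Matrix (Fin 2) (Fin 2) ℂ) 0 1).re = ((y' e : Matrix (Fin 2) (Fin 2) ℂ) 0 1).re := by
      simpa [hι] using hq 2
    have h3 : ((y e : Matrix (Fin 2) (Fin 2) ℂ) 0 1).im = ((y' e : Matrix (Fin 2) (Fin 2) ℂ) 0 1).im := by
      simpa [hι] using hq 3
    have ha : (y e : Matrix (Fin 2) (Fin 2) ℂ) 0 0 = (y' e : Matrix (Fin 2) (Fin 2) ℂ) 0 0 := Complex.ext h0 h1
    have hb : (y e : Matrix (Fin 2) (Fin 2) ℂ) 0 1 = (y' e : Matrix (Fin 2) (Fin 2) ℂ) 0 1 := Complex.ext h2 h3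
    apply Subtype.ext
    ext i j
    fin_cases i <;> fin_cases j
    · exact ha
    · exact hb
    · simp only [Fin.mk_one, Fin.isValue, Fin.zero_eta]
      rw [apply_one_zero_eq (y e).2, apply_one_zero_eq (y' e).2, hb]
    · simp only [Fin.mk_one, Fin.isValue]
      rw [apply_one_one_eq (y e).2, apply_one_one_eq (y' e).2, ha]
  have hιemb : MeasurableEmbedding ι := (hιc.isClosedEmbedding hιinj).measurableEmbedding
  -- the Euclidean pairing with a covector is a ridge sum
  have hridge : ∀ ξ : EuclideanSpace ℝ (Edge 3 L × Fin 4), ∃ (r : Edge 3 L → ℝ)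
      (g : Edge 3 L → Matrix.specialUnitaryGroup (Fin 2) ℂ), ∀ y,
      inner ℝ (ι y) ξ = ∑ e, r e * (hsForm 2 (fundamentalRep (Fin 2) (g e)) (fundamentalRep (Fin 2) (y e)) / 2) := by
    intro ξ
    have hv := fun e : Edge 3 L => exists_smul_hsForm_eq_pairing (fun k : Fin 4 => ξ (e, k))
    choose r g hrg using hv
    refine ⟨r, g, fun y => ?_⟩
    rw [PiLp.inner_apply, Fintype.sum_prod_type]
    refine Finset.sum_congr rfl fun e _ => ?_
    rw [← hrg e (y e), Fin.sum_univ_four]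
    simp only [hι, real_inner_eq_re_inner, Matrix.cons_val_zero, Matrix.cons_val_one, Matrix.cons_val_two,
      Matrix.cons_val_three]
    simp [mul_comm]
  -- characteristic functions of the image measures agree
  have hcf : charFun (μ.map ι) = charFun (ν.map ι) := by
    funext ξ
    obtain ⟨r, g, hrg⟩ := hridge ξ
    have hcont : Continuous fun x : EuclideanSpace ℝ (Edge 3 L × Fin 4) => Complex.exp (((inner ℝ x ξ : ℝ) : ℂ) * Complex.I) :=
      Complex.continuous_exp.comp ((Complex.continuous_ofReal.comp (continuous_id.inner continuous_const)).mul
        continuous_const)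
    rw [charFun_apply, charFun_apply, integral_map hιc.measurable.aemeasurable hcont.aestronglyMeasurable,
      integral_map hιc.measurable.aemeasurable hcont.aestronglyMeasurable]
    simp_rw [hrg]
    exact integral_cexp_ridge_eq h g r
  have hmap : μ.map ι = ν.map ι := Measure.ext_of_charFun hcf
  ext A hA
  rw [← Set.preimage_image_eq A hιinj, ← hιemb.map_apply μ, ← hιemb.map_apply ν, hmap]

end Summit.QuantumFields.YangMills.Theorems.ColdStartUniversality

end
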